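import Literature.Probability.Percolation.SelfRefinementMeasure
import Literature.Probability.Percolation.KSTPeriodicWeak

/-!
# From the weak periodic RSW theorem to box-crossing bounds, part 1: the primal measure

Support file for item `stmt-CriticalPhenomena-10267` (route `CardySelfRefinement`, crux
`CriticalPathRSW`, line finite-size-envelope, stub `stub_rswOfCertificates3`).

The self-refinement law `M_k(ρ, c) = selfRefinementMeasure k ρ c` (`k ≠ 0`) satisfies the standing
hypotheses `KSTPeriodic.Admissible k 0` of the weak periodic Russo–Seymour–Welsh theorem
(Köhler-Schindler–Tassion, Duke Math. J. 172 (2023), Theorem 1 with Comment 1): invariance under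
the translations of `kℤ²`, under the transposition and under the reflection `x ↦ (-x₀, x₁)`
(`= flipEquiv 0`), and positive association; it is carried by lattice configurations. The
easy-way certificate `M_k(𝓒(kn, 3kn)) ≥ ε` for `n ≥ n₀` gives the short-way hypothesis
`M_k(𝓒₀(N, 8N)) ≥ ε` at the scales `N ≥ k n₀` divisible by `k` (inclusion of events), and the
coarse row `y = 0` consists of axial edges, each open with probability `1/2`, so that by the
Harris–FKG inequality a row segment of length `L` is open with probability `≥ 2^{-L}`. The weak
theorem `WeakPeriodicRSW k 0` therefore yields long crossings `M_k(𝓒₀(ρ' N, N)) ≥ c₁` for all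
`N ≥ N₁`, with `c₁, N₁` depending on `(k, ε, n₀, ρ')` only (`RswCert.primal_long`).
-/

noncomputable section

namespace Summit.CriticalPhenomena.CardyFormulaZ2.Cruxes.CriticalPathRSW.FiniteSizeEnvelope

open Set MeasureTheory Filter Topology
open Literature.Probability.LatticeModels Literature.Probability.Percolation

namespace RswCert

/-! ### Admissibility of `M_k(ρ, c)` -/

/-- The reflection `flipEquiv 0 : x ↦ (-x₀, x₁)` is the tree's `reflectIso 0`. -/
theorem flipEquiv_zero_eq : KSTPeriodic.flipEquiv 0 = (reflectIso (0 : Fin 2)).toEquiv := by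
  refine Equiv.ext fun x => ?_
  ext j
  fin_cases j <;> simp

/-- **`M_k(ρ, c)` is admissible** (`k ≠ 0`): invariant under `kℤ²`, the transposition and the
reflection in `x₀ = 0`, and positively associated. -/
theorem admissible_selfRefinementMeasure {k : ℕ} (hk : k ≠ 0) (ρ c : ℝ) :
    KSTPeriodic.Admissible k 0 (selfRefinementMeasure k ρ c) where
  shift_inv v := selfRefinementMeasure_map_relabel_shift hk ρ c v
  transpose_inv := selfRefinementMeasure_map_relabel_transpose k ρ c
  flip_inv := by
    rw [flipEquiv_zero_eq]
    exact selfRefinementMeasure_map_relabel_reflect hk ρ c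
  posAssoc := isPositivelyAssociated_selfRefinementMeasure k ρ c

/-- `M_k(ρ, c)` is carried by lattice configurations. -/
theorem latticeCarried_selfRefinementMeasure (k : ℕ) (ρ c : ℝ) :
    KSTPeriodic.LatticeCarried (selfRefinementMeasure k ρ c) :=
  selfRefinementMeasure_ae_subset_edgeSet k ρ c

/-! ### The short-way hypothesis from the easy-way certificate -/

/-- The easy-way certificate `μ(𝓒(kn, 3kn)) ≥ ε` (`n ≥ n₀`) gives `μ(𝓒₀(N, 8N)) ≥ ε` at every
scale `N ≥ k n₀` divisible by `k` (`𝓒(N, 3N) ⊆ 𝓒(N, 8N)` on lattice configurations). -/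
theorem shortWay_of_easy {k n₀ : ℕ} (hk : 1 ≤ k) {ε : ℝ} {μ : Measure (BondConfig (Site 2))}
    [IsFiniteMeasure μ] (hL : KSTPeriodic.LatticeCarried μ)
    (hcert : ∀ n : ℕ, n₀ ≤ n → ε ≤ μ.real (KST2023.crossing (k * n) (3 * (k * n)))) :
    ∀ N : ℕ, k * n₀ ≤ N → k ∣ N → ε ≤ μ.real (KSTPeriodic.crossing 0 N (8 * N)) := by
  rintro N hN ⟨n, rfl⟩
  have hn : n₀ ≤ n := Nat.le_of_mul_le_mul_left hN (by omega)
  calc ε ≤ μ.real (KST2023.crossing (k * n) (3 * (k * n))) := hcert n hn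
    _ = μ.real (KSTPeriodic.crossing 0 (k * n) (3 * (k * n))) := by
        rw [KSTPeriodic.crossing_zero_eq]
    _ ≤ μ.real (KSTPeriodic.crossing 0 (k * n) (8 * (k * n))) :=
        KSTPeriodic.real_crossing_mono hL le_rfl (by omega)

/-! ### Row finite energy on the coarse row `y = 0` -/

/-- The horizontal edge from `(x, 0)` to `(x + 1, 0)` is the corner edge based at `(x, 0)`. -/
theorem mk_row_zero_eq_cornerEdge (x : ℤ) :
    s((![x, 0] : Site 2), ![x + 1, 0]) = cornerEdge ((![x, 0] : Site 2), (0 : Fin 2)) := by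
  simp only [cornerEdge]
  congr 1
  ext j
  fin_cases j <;> simp

/-- **Row finite energy of `M_k(ρ, c)` on the coarse row**: the horizontal edges of the row
`y = 0` are axial, each open with probability `1/2`, and by positive association a segment of
`L` of them is open with probability at least `2^{-L}`. -/
theorem rowSegment_selfRefinementMeasure (k : ℕ) (ρ c : ℝ) (a : ℤ) (L : ℕ) :
    (1 / 2 : ℝ) ^ L ≤ (selfRefinementMeasure k ρ c).real
      {ω | ∀ i : ℕ, i < L → s((![a + i, 0] : Site 2), ![a + i + 1, 0]) ∈ ω} := by
  set E : Fin L → Set (BondConfig (Site 2)) :=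
    fun i => {ω | cornerEdge ((![a + (i : ℕ), 0] : Site 2), (0 : Fin 2)) ∈ ω} with hE
  have hup : ∀ i, IsUpperSet (E i) := fun i ω ω' h hω => h hω
  have hmeas : ∀ i, MeasurableSet (E i) := fun i => (measurable_set_mem _).setOf
  have hval : ∀ i, (selfRefinementMeasure k ρ c).real (E i) = 1 / 2 := fun i =>
    selfRefinementMeasure_real_cornerEdge_mem_of_isAxialEdge k ρ c (by simp)
  have hset : {ω : BondConfig (Site 2) | ∀ i : ℕ, i < L → s((![a + i, 0] : Site 2), ![a + i + 1, 0]) ∈ ω} =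
      ⋂ i : Fin L, E i := by
    ext ω
    simp only [Set.mem_setOf_eq, Set.mem_iInter, hE, ← mk_row_zero_eq_cornerEdge]
    exact ⟨fun h i => h i i.2, fun h i hi => h ⟨i, hi⟩⟩
  rw [hset]
  calc (1 / 2 : ℝ) ^ L = ∏ i : Fin L, (selfRefinementMeasure k ρ c).real (E i) := by
        simp [hval]
    _ ≤ (selfRefinementMeasure k ρ c).real (⋂ i, E i) :=
        (isPositivelyAssociated_selfRefinementMeasure k ρ c).prod_real_le_iInter hup hmeas

/-! ### Long crossings of `M_k(ρ, c)` on the certificate set -/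

/-- **Primal long crossings on the certificate set.** From the weak periodic RSW theorem for
`t = 0`: for `k ≥ 1`, `ε > 0`, a base scale `n₀` and an integer aspect ratio `ρ' ≥ 1` there are
`c₁ > 0` and `N₁` such that every `M_k(ρ, c)` with the easy-way certificate
`M_k(𝓒(kn, 3kn)) ≥ ε` for all `n ≥ n₀` crosses `R_0(ρ' N, N)` the long way with probability
`≥ c₁` at every scale `N ≥ N₁`. -/
theorem primal_long (hW : ∀ k t : ℕ, 1 ≤ k → t ≤ k → KSTPeriodic.WeakPeriodicRSW k t)
    {k : ℕ} (hk : 1 ≤ k) {ε : ℝ} (hε : 0 < ε) (n₀ ρ' : ℕ) (hρ' : 1 ≤ ρ') :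
    ∃ c₁ : ℝ, 0 < c₁ ∧ ∃ N₁ : ℕ, ∀ ρ c : ℝ,
      (∀ n : ℕ, n₀ ≤ n →
        ε ≤ (selfRefinementMeasure k ρ c).real (KST2023.crossing (k * n) (3 * (k * n)))) →
      ∀ N : ℕ, N₁ ≤ N → c₁ ≤ (selfRefinementMeasure k ρ c).real (KSTPeriodic.crossing 0 (ρ' * N) N) := by
  obtain ⟨c₁, hc₁, N₁, h⟩ := hW k 0 hk (Nat.zero_le k) ε (1 / 2) hε (by norm_num) (k * n₀) ρ' hρ'
  refine ⟨c₁, hc₁, N₁, fun ρ c hcert N hN => ?_⟩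
  exact h (selfRefinementMeasure k ρ c) (admissible_selfRefinementMeasure (by omega) ρ c)
    (latticeCarried_selfRefinementMeasure k ρ c)
    (shortWay_of_easy hk (latticeCarried_selfRefinementMeasure k ρ c) hcert)
    ⟨0, fun a L => rowSegment_selfRefinementMeasure k ρ c a L⟩ N hN

end RswCert

/-- **Headline of this support file** (registered sub-stub `stub_rswOfCertificates3_primal` of
`stub_rswOfCertificates3`): primal long crossings of `M_k(ρ, c)` on the easy-way certificate set,
from the weak periodic RSW theorem at offset `t = 0`. -/
theorem stub_rswOfCertificates3_primal :
    (∀ k t : ℕ, 1 ≤ k → t ≤ k → KSTPeriodic.WeakPeriodicRSW k t) →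
      ∀ k : ℕ, 1 ≤ k → ∀ ε : ℝ, 0 < ε → ∀ n₀ ρ' : ℕ, 1 ≤ ρ' →
        ∃ c₁ : ℝ, 0 < c₁ ∧ ∃ N₁ : ℕ, ∀ ρ c : ℝ,
          (∀ n : ℕ, n₀ ≤ n →
            ε ≤ (selfRefinementMeasure k ρ c).real (KST2023.crossing (k * n) (3 * (k * n)))) →
          ∀ N : ℕ, N₁ ≤ N →
            c₁ ≤ (selfRefinementMeasure k ρ c).real (KSTPeriodic.crossing 0 (ρ' * N) N) :=
  fun hW _ hk _ hε n₀ ρ' hρ' => RswCert.primal_long hW hk hε n₀ ρ' hρ'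

end Summit.CriticalPhenomena.CardyFormulaZ2.Cruxes.CriticalPathRSW.FiniteSizeEnvelope

end
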